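/-
Copyright: the b2b-balaban T⁴-continuum CRUX team, row NE7b OWNER lineage `t4-ne7b-p1` (gen 128). Project licence.
-/
import Summits.QuantumFields.BalabanUV.T4Continuum.Spine.NE7b.SupFibreScaleRegulatedGas

/-!
# LARGE-FIELD CELLS ARE RARE, MULTIPLICATIVELY (the Peierls brick of the large-field bookkeeping): under `N(0,Γ)` with `Γ ⪯ γ_op·1`,
# diagonal `≤ γ`, and disjoint cells of `≤ v` sites, for EVERY finite family `L` of cells and every threshold `Ψ`,
# `P(∀ p ∈ L, Σ_{x∈cell p} ω_x² ≥ Ψ²) ≤ (e^{−½κΨ²}·A^v)^{#L}`, `A = (1−θ)^{−κγ∕(2θ)}`, for any regulator strength `κ ≥ 0` with `κγ_op ≤ θ < 1`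
# — so at scale `N` of the fluctuation measure (`γ_op = γ = K_N = O(4^{−N})`, `κ` up to `θ∕K_N`) a prescribed set of `#L` large-field cells
# costs `(e^{−½θΨ²∕K_N}·(1−θ)^{−v∕2})^{#L}`: exponentially small per cell at fine scales, with NO volume factor (row NE7b, node U5c; (288)'s
# exponential Chebyshev + (289)∕(291) BY NAME; [folklore])

Cell `pub-balaban`, sub-cell `t4`, spine estimate NE7b (`T4WeightBudget.RelWeightBound`; the cell's OWN estimate — NOT PRINTED in
[Bałaban 1983–89], NOT PROVED).  Crux-route work under `Spine/NE7b/` by the row OWNER (`t4-ne7b-p1` gen 128, file (294)) under FREEZE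
(0)'s crux-prover clause, on § [NE7bP1-G127-HANDOFF] NEXT (3)(b) (the large-field half of SCOPING-d2); NOTHING of Bałaban's is named as a
Lean object, valued or asserted; no `T4Continuum/Support` leaf typed; no `def`, no notation; zero `sorry`.  Imports (BY NAME): the OWNER's
(288) `…SupGaussianRegulator` (`measureReal_sum_sq_ge_le`), (289) `…SupRegulatedActivityBound` (`card_biUnion_cell_le`, `one_le_regulatorCost`),
(291) `…SupFibreScaleRegulatedGas` (`scale_opBound`, `scale_const_nonneg`), (280) `scale_posSemidef`, (285) `scale_diag_le`.

WHY (located).  (292) showed that the polymer gas of the shifted factors converges where the external field is small on cells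
(`Σ_{cell p}ψ² ≤ Ψ²`) and is only BOUNDED (with the cell regulator `e^{½κ(1+τ⁻¹)Σψ²}`) elsewhere; extensivity of the large-field
contribution therefore rests on the cells where `ψ` is large being RARE under the next Gaussian integration — and rare MULTIPLICATIVELY in
their number, not through (285)'s union bound (which carries the volume).  This file proves exactly that Peierls-type estimate from (288)'s
exponential Chebyshev inequality: the event «all cells of `L` are large» forces `Σ_{x∈⋃L}ω_x² ≥ #L·Ψ²`, whose probability is
`≤ e^{−½κ#LΨ²}A^{#⋃L} ≤ (e^{−½κΨ²}A^v)^{#L}`.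

WHAT IS PROVED ([folklore]):
* §1 `sum_biUnion_ge_of_cells` (all cells of `L` large ⟹ `#L·Ψ² ≤ Σ_{x∈⋃_{p∈L}cell p}ω_x²`), `largeCells_subset`;
* §2 **`measureReal_largeCells_le`** (`P(∀ p ∈ L, Ψ² ≤ Σ_{x∈cell p}ω_x²) ≤ (e^{−½κΨ²}·A^v)^{#L}` under `N(0,Γ)`, `Γ ⪯ γ_op·1`, diagonal `≤ γ`,
  `0 ≤ γ`, `0 ≤ κ`, `0 < θ < 1`, `κγ_op ≤ θ`);
* §3 **`scale_measureReal_largeCells_le`** (the same at scale `N` of (280)'s split for (273)'s data: `γ_op = γ = K_N`); §4 toy.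

HONEST (what this is NOT).  A probability estimate for a PRESCRIBED family of large cells (the Peierls brick); the resummation over families
(large-field regions, their entropy `≤ (Δ+1)`-type lattice-animal counts — the tree's `PolymerGasGeometric.sum_pow_card_le_of_connected`) and
the coupling with (292)'s bounded activities into one extensive bound are the successor's; one scale; scalar skeleton ((A3), NC-NE7b-α
UNRULED); nothing of Bałaban's asserted.  BY-NAME EFFECT ON THE WALL: NONE.  NE7b NOT PRINTED ∕ NOT PROVED; spine PROVED 0∕9; rung (B)+1 —
the programme's measures remain FINITE-torus statements; NOT the mass gap, NOT Clay.  HONEST DEPENDENCY: continuum YM on T⁴ ⇐ BetaPertH ∧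
nine spine estimates (0∕9 proved); BetaPertH ⇐ (D1) ∧ (D4) ∧ CAP+tail; G-an2-4 gates asym, D1 and NE2∕3∕4.
-/

set_option autoImplicit false

noncomputable section

namespace Summit.QuantumFields.BalabanUV.T4Continuum.NE7b.SupLargeFieldCellsRare

open MeasureTheory ProbabilityTheory Finset Real Matrix
open scoped BigOperators
open Literature.Analysis.Matrix (frdPiece)
open SupGaussianRegulator (measureReal_sum_sq_ge_le)
open SupRegulatedActivityBound (card_biUnion_cell_le one_le_regulatorCost)
open SupFibreGaussianScaleSplit (scale_posSemidef)
open SupFibreScaleSmallField (scale_diag_le)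
open SupFibreScaleRegulatedGas (scale_opBound scale_const_nonneg)

variable {ι : Type} [Fintype ι] [DecidableEq ι] {V : Type*}

/-! ## §1. All cells of `L` large ⟹ the field is large on `⋃L` -/

omit [Fintype ι] in
/-- **ALL CELLS LARGE ⟹ LARGE ON THE UNION**: for pairwise disjoint cells, `Ψ² ≤ Σ_{x∈cell p}ω_x²` for every `p ∈ L` ⟹
`#L·Ψ² ≤ Σ_{x∈⋃_{p∈L}cell p}ω_x²`. [folklore] -/
theorem sum_biUnion_ge_of_cells [DecidableEq V] (cell : V → Finset ι) (hdisj : ∀ p q, p ≠ q → Disjoint (cell p) (cell q))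
    (L : Finset V) {Ψ : ℝ} (ω : EuclideanSpace ℝ ι) (hL : ∀ p ∈ L, Ψ ^ 2 ≤ ∑ x ∈ cell p, ω x ^ 2) :
    (L.card : ℝ) * Ψ ^ 2 ≤ ∑ x ∈ L.biUnion cell, ω x ^ 2 := by
  have hpd : (L : Set V).PairwiseDisjoint cell := fun p _ q _ hpq => hdisj p q hpq
  rw [sum_biUnion hpd]
  calc (L.card : ℝ) * Ψ ^ 2 = ∑ _p ∈ L, Ψ ^ 2 := by rw [sum_const, nsmul_eq_mul]
    _ ≤ ∑ p ∈ L, ∑ x ∈ cell p, ω x ^ 2 := sum_le_sum hL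

omit [Fintype ι] in
/-- The event «all cells of `L` are large» lies inside «the field is large on `⋃L`». [folklore] -/
theorem largeCells_subset [DecidableEq V] (cell : V → Finset ι) (hdisj : ∀ p q, p ≠ q → Disjoint (cell p) (cell q)) (L : Finset V)
    (Ψ : ℝ) :
    {ω : EuclideanSpace ℝ ι | ∀ p ∈ L, Ψ ^ 2 ≤ ∑ x ∈ cell p, ω x ^ 2} ⊆
      {ω : EuclideanSpace ℝ ι | (L.card : ℝ) * Ψ ^ 2 ≤ ∑ x ∈ L.biUnion cell, ω x ^ 2} :=
  fun ω hω => sum_biUnion_ge_of_cells cell hdisj L ω hω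

/-! ## §2. The Peierls brick -/

/-- **LARGE-FIELD CELLS ARE RARE, MULTIPLICATIVELY IN THEIR NUMBER.**  `Γ ⪰ 0`, `Γ ⪯ γ_op·1`, diagonal `≤ γ` (`γ ≥ 0`); pairwise disjoint
cells of `≤ v` sites; `0 ≤ κ`, `0 < θ < 1`, `κγ_op ≤ θ` ⟹ for every finite family `L` of cells and every `Ψ`:
`P_{N(0,Γ)}(∀ p ∈ L, Ψ² ≤ Σ_{x∈cell p}ω_x²) ≤ (e^{−½κΨ²}·A^v)^{#L}`, `A = (1−θ)^{−κγ∕(2θ)}`. [folklore] -/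
theorem measureReal_largeCells_le [DecidableEq V] {Γ : Matrix ι ι ℝ} {γop γ : ℝ} (hΓ : Γ.PosSemidef)
    (hΓop : (γop • (1 : Matrix ι ι ℝ) - Γ).PosSemidef) (hdiag : ∀ i, Γ i i ≤ γ) (hγ : 0 ≤ γ) (cell : V → Finset ι)
    (hdisj : ∀ p q, p ≠ q → Disjoint (cell p) (cell q)) {v : ℕ} (hv : ∀ p, (cell p).card ≤ v) {κ θ : ℝ} (hκ : 0 ≤ κ) (hθ0 : 0 < θ)
    (hθ1 : θ < 1) (hκθ : κ * γop ≤ θ) (L : Finset V) (Ψ : ℝ) :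
    (multivariateGaussian 0 Γ).real {ω : EuclideanSpace ℝ ι | ∀ p ∈ L, Ψ ^ 2 ≤ ∑ x ∈ cell p, ω x ^ 2} ≤
      (exp (-(κ * Ψ ^ 2 / 2)) * ((1 - θ) ^ (-(κ * γ / (2 * θ)))) ^ v) ^ L.card := by
  set μ := multivariateGaussian 0 Γ with hμ
  set A : ℝ := (1 - θ) ^ (-(κ * γ / (2 * θ))) with hA
  have hA1 : 1 ≤ A := one_le_regulatorCost (mul_nonneg hκ hγ) hθ0 hθ1
  have hmono : μ.real {ω : EuclideanSpace ℝ ι | ∀ p ∈ L, Ψ ^ 2 ≤ ∑ x ∈ cell p, ω x ^ 2} ≤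
      μ.real {ω : EuclideanSpace ℝ ι | (L.card : ℝ) * Ψ ^ 2 ≤ ∑ x ∈ L.biUnion cell, ω x ^ 2} :=
    measureReal_mono (largeCells_subset cell hdisj L Ψ) (measure_ne_top μ _)
  have hcheb := measureReal_sum_sq_ge_le hΓ hΓop hκ hθ0 hθ1 hκθ (L.biUnion cell) (fun i _ => hdiag i) ((L.card : ℝ) * Ψ ^ 2)
  refine hmono.trans (hcheb.trans ?_)
  -- `e^{−½κ#LΨ²}·A^{#⋃L} ≤ e^{−½κ#LΨ²}·A^{v#L} = (e^{−½κΨ²}A^v)^{#L}`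
  calc exp (-(κ * ((L.card : ℝ) * Ψ ^ 2) / 2)) * A ^ (L.biUnion cell).card
      ≤ exp (-(κ * ((L.card : ℝ) * Ψ ^ 2) / 2)) * A ^ (v * L.card) :=
        mul_le_mul_of_nonneg_left (pow_le_pow_right₀ hA1 (card_biUnion_cell_le cell hv L)) (exp_pos _).le
    _ = (exp (-(κ * Ψ ^ 2 / 2)) * A ^ v) ^ L.card := by
        rw [mul_pow, ← pow_mul, ← Real.exp_nat_mul]
        congr 2
        ring

/-! ## §3. At scale `N` of the fluctuation measure -/

section Scale

variable {ι' : Type*} [Fintype ι'] {σ : Type} [Fintype σ] [DecidableEq σ]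
  {H : (ι' → ℝ) →L[ℝ] (ι' → ℝ) →L[ℝ] ℝ} {m p ΛH q : ℝ} (P : (σ → ℝ) →L[ℝ] (ι' → ℝ))

/-- **THE PEIERLS BRICK AT SCALE `N`**: for (273)'s data (`H` symmetric with floor `m` and ceiling `Λ_H`, chart `P` with bound `p` and ceiling
`q`, `M_z(j,k) = H(Pe_j)(Pe_k)`, `c = 4∕(Λ_Hq)`, `K_N = c·π⁴∕(4·4^N·(cmp)²)`), pairwise disjoint chart cells of `≤ v` indices, `0 ≤ κ`,
`0 < θ < 1`, `κK_N ≤ θ`: under the scale-`N` law `N(0, c·C_N(cM_z))`, for every finite family `L` of cells and every `Ψ`,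
`P(∀ p ∈ L, Ψ² ≤ Σ_{j∈cell p}ω_j²) ≤ (e^{−½κΨ²}·A_N^v)^{#L}`, `A_N = (1−θ)^{−κK_N∕(2θ)}`. [folklore] -/
theorem scale_measureReal_largeCells_le [DecidableEq V] (hHsym : ∀ h k : ι' → ℝ, H h k = H k h)
    (hfl : ∀ h : ι' → ℝ, m * ∑ x, h x ^ 2 ≤ H h h) (hm : 0 < m) (hceil : ∀ h : ι' → ℝ, H h h ≤ ΛH * ∑ x, h x ^ 2) (hΛH : 0 < ΛH)
    (hP : ∀ z : σ → ℝ, p * ∑ i, z i ^ 2 ≤ ∑ x, P z x ^ 2) (hp : 0 < p) (hPceil : ∀ z : σ → ℝ, ∑ x, P z x ^ 2 ≤ q * ∑ i, z i ^ 2)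
    (hq : 0 < q) (Mz : Matrix σ σ ℝ) (hMz : ∀ j k, Mz j k = H (P (Pi.single j 1)) (P (Pi.single k 1))) (N : ℕ)
    (cell : V → Finset σ) (hdisj : ∀ p' q', p' ≠ q' → Disjoint (cell p') (cell q')) {v : ℕ} (hv : ∀ p', (cell p').card ≤ v)
    {κ θ : ℝ} (hκ : 0 ≤ κ) (hθ0 : 0 < θ) (hθ1 : θ < 1)
    (hκθ : κ * ((4 / (ΛH * q)) * (π ^ 4 / (4 * 4 ^ N * ((4 / (ΛH * q)) * m * p) ^ 2))) ≤ θ) (L : Finset V) (Ψ : ℝ) :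
    (multivariateGaussian 0 ((4 / (ΛH * q)) • frdPiece ((4 / (ΛH * q)) • Mz) N)).real
        {ω : EuclideanSpace ℝ σ | ∀ p' ∈ L, Ψ ^ 2 ≤ ∑ j ∈ cell p', ω j ^ 2} ≤
      (exp (-(κ * Ψ ^ 2 / 2)) * ((1 - θ) ^ (-(κ * ((4 / (ΛH * q)) * (π ^ 4 / (4 * 4 ^ N * ((4 / (ΛH * q)) * m * p) ^ 2)))
        / (2 * θ)))) ^ v) ^ L.card :=
  measureReal_largeCells_le (scale_posSemidef P hHsym Mz hMz (by positivity) N)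
    (scale_opBound P hHsym hfl hm hceil hΛH hP hp hPceil hq Mz hMz N) (scale_diag_le P hHsym hfl hm hceil hΛH hP hp hPceil hq Mz hMz N)
    (scale_const_nonneg hm hΛH hp hq N) cell hdisj hv hκ hθ0 hθ1 hκθ L Ψ

end Scale

/-! ## §4. Toy -/

/-- Toy (§1): with one cell `{0, 1} ⊆ Fin 2` required large at level `Ψ`, the union carries at least `1·Ψ²`. -/
example (ω : EuclideanSpace ℝ (Fin 2)) (Ψ : ℝ) (h : ∀ p ∈ ({()} : Finset Unit), Ψ ^ 2 ≤ ∑ x ∈ (fun _ : Unit => (Finset.univ : Finset (Fin 2))) p, ω x ^ 2) :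
    ((({()} : Finset Unit).card : ℝ)) * Ψ ^ 2 ≤ ∑ x ∈ ({()} : Finset Unit).biUnion (fun _ : Unit => (Finset.univ : Finset (Fin 2))), ω x ^ 2 :=
  sum_biUnion_ge_of_cells (fun _ : Unit => Finset.univ) (fun p q hpq => absurd (Subsingleton.elim p q) hpq) {()} ω h

end Summit.QuantumFields.BalabanUV.T4Continuum.NE7b.SupLargeFieldCellsRare
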